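import Literature.NumberTheory.GelbartRogawski1991.LocalSymplecticEmbeddingGaloisConj
import Literature.NumberTheory.GelbartRogawski1991.LocalKudlaSplittingRigidity
import HarnessLib

/-!
# `g ↦ ḡ` on the doubled unitary group: the Siegel parabolic `P_Δ` is stable and `det_Δ ḡ = c_*(det_Δ g)`

Topic `NumberTheory/GelbartRogawski1991`; namespace `Literature.NumberTheory.GelbartRogawski1991.UnitaryDualPair.LocalSplitting` (home of ★
`IsSiegelDelta`, `deltaBlock`, `detDelta`, `iota`).  KERNEL ONLY: theorems; no definition, no named fact, no `sorry`.  Cell `hodgecm-mathlib`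
(D-0151), programme P5 (crux HLiu418 = stmt-HodgeConjecture-24832), piece **P1a** of the road card `F0/P5/A-p18/g23/ROAD-L4if-v2.A-p18g23.md`
§4 (A-p18 (g23), 2026-08-31): the two facts about the entrywise conjugation `bar = localPiGalConj` (★ p834029) on the DOUBLED local group
`H(F_v) = U(T₀ ⊕ −T₀)(F_v)` that Kudla rigidity (★ `eq_of_parabolic_toRep_conj_eq`) needs in order to pin the conjugate of the `P_Δ`-normalised
CM section: `bar` preserves the Siegel parabolic, and it conjugates Kudla's `x(p) = det_Δ p`.

THE MATHEMATICS ([Kudla1994, §3]; [HarrisKudlaSweet1996, §1 (1.11), (1.15)]).  `E/F` quadratic with conjugation `c`, `δ` trace-zero, `v` a finite place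
of `F`, `T₀ ∈ Sym_n(F)`, `J^𝔻 = (T₀ ⊕ −T₀) ⊗ 1`, `H(F_v) = U(J^𝔻)(F_v)` in factor form (★ `localPi E c (n+n) JD v`), `P_Δ(F_v)` the stabiliser of
the diagonal Lagrangian `ℓ_Δ` (★ `IsSiegelDelta`), `det_Δ p ∈ E_w` the determinant of the `Δ`-block at `w ∣ v` (★ `detDelta`).
* §1 `p̄ ∈ P_Δ ↔ p ∈ P_Δ` (`isSiegelDelta_localPiGalConj_iff`): `ι^𝔻_δ(p̄) = ι^𝔻_{−δ}(p)` (★ `iota_neg_eq_iota_galConj`) and `P_Δ` does not depend on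
  the trace-zero element used to realise `ι^𝔻` (★ `isSiegelDelta_iff_of_delta`).
* §2 the `w`-component of `p̄` is `c_*` of the `c⁻¹w`-component of `p`, entrywise (`coe_localPiGalConj_apply`) — the definition of `c ⊗ 1` on
  `E_v = ∏_{w∣v} E_w` (★ `conjLocal_apply`); hence `deltaBlock w p̄ = (deltaBlock (c⁻¹w) p).map c_*` and
  **`det_Δ(p̄)_w = c_*(det_Δ(p)_{c⁻¹w})`** (`detDelta_localPiGalConj`).
Consequence for the road (stated in the card, proved in the P1 file): the `P_Δ`-scalar `∏_w χ_w⁻¹(det_Δ p̄_w)⁻¹‖det_Δ p̄_w‖^{1/2}` of the `χ`-normalised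
doubled CM section at `p̄` is the scalar of the `χᶜ`-normalised section at `p`, so `Σ_χ ∘ bar` is the `χᶜ`-section by rigidity.
Nothing of the cited sources is asserted; HC_CM is proved only modulo the printed citations until rung 0 closes.

## References
* [Kudla1994] S. Kudla, *Splitting metaplectic covers of dual reductive pairs*, Israel J. Math. 87 (1994), §3 (the Siegel parabolic and `x(p)`).
* [HarrisKudlaSweet1996] M. Harris, S. Kudla, W. Sweet, *Theta dichotomy for unitary groups*, J. AMS 9 (1996), §1 (1.11), (1.15).
* [MoeglinVignerasWaldspurger1987] C. Mœglin, M.-F. Vignéras, J.-L. Waldspurger, LNM 1291 (1987), Chap. 1 I.17.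
-/

set_option autoImplicit false

noncomputable section

open NumberField IsDedekindDomain Matrix
open Literature.NumberTheory.Automorphic Literature.NumberTheory.Automorphic.UnitaryGroup

namespace Literature.NumberTheory.GelbartRogawski1991.UnitaryDualPair.LocalSplitting

variable (F : Type) [Field F] [NumberField F] (E : Type) [Field E] [NumberField E] [Algebra F E]
  [Algebra.IsQuadraticExtension F E] (c : E ≃ₐ[F] E)
  {δ : E} (hcδ : c δ = -δ) (hδ : δ ≠ 0) {d : F} (hd : δ * δ = algebraMap F E d)
  (v : HeightOneSpectrum (𝓞 F)) (n : ℕ) {T₀ : Matrix (Fin n) (Fin n) F} (hT₀ : T₀.IsSymm)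
  {JD : Matrix (Fin (n + n)) (Fin (n + n)) E} (hJD : JD = (gramD F n T₀).map (algebraMap F E))

/-! ## §1 `bar` preserves the Siegel parabolic -/

/-- **`p̄ ∈ P_Δ(F_v) ↔ p ∈ P_Δ(F_v)`** for the doubled local unitary group: `ι^𝔻_δ(p̄) = ι^𝔻_{−δ}(p)` and `P_Δ` is independent of the trace-zero
element realising `ι^𝔻`. [cite: Kudla1994, §3] [cite: HarrisKudlaSweet1996, §1 (1.11)] -/
theorem isSiegelDelta_localPiGalConj_iff (p : UnitaryGroup.localPi E c (n + n) JD v) :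
    IsSiegelDelta F E c hcδ hδ hd v n hT₀ hJD (localPiGalConj E c (n + n) v hJD p) ↔ IsSiegelDelta F E c hcδ hδ hd v n hT₀ hJD p := by
  have hcδ' : c (-δ) = -(-δ) := by rw [map_neg, hcδ]
  have hδ' : -δ ≠ 0 := neg_ne_zero.2 hδ
  have hd' : -δ * -δ = algebraMap F E d := by rw [neg_mul_neg, hd]
  rw [← isSiegelDelta_iff_of_delta F E c hcδ hδ hd v n hcδ' hδ' hd' hT₀ hT₀ hJD hJD p]
  unfold IsSiegelDelta iotaD
  rw [iota_neg_eq_iota_galConj F E c (n + n) hcδ hδ hd hcδ' hδ' hd' (gramD F n T₀) (gramD_isSymm F n hT₀) hJD v p]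

/-- `P_Δ` membership of `p̄` from that of `p` (the direction Kudla rigidity consumes). [cite: Kudla1994, §3] -/
theorem IsSiegelDelta.localPiGalConj {p : UnitaryGroup.localPi E c (n + n) JD v} (hp : IsSiegelDelta F E c hcδ hδ hd v n hT₀ hJD p) :
    IsSiegelDelta F E c hcδ hδ hd v n hT₀ hJD (localPiGalConj E c (n + n) v hJD p) :=
  (isSiegelDelta_localPiGalConj_iff F E c hcδ hδ hd v n hT₀ hJD p).2 hp

/-! ## §2 Components of `p̄` and `det_Δ(p̄)` -/

omit [Algebra.IsQuadraticExtension F E] in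
/-- **The `w`-component of `ḡ` is `c_*` of the `c⁻¹w`-component of `g`, entrywise** (any rank `N`, any `F`-rational `J = T ⊗ 1`): this is the
definition of `c ⊗ 1` on `E_v = ∏_{w ∣ v} E_w` (★ `conjLocal_apply`) read through the regrouping `GL_N(∏ E_w) = ∏ GL_N(E_w)`.
[cite: MoeglinVignerasWaldspurger1987, Chap. 1 I.17] -/
theorem coe_localPiGalConj_apply {N : ℕ} {T : Matrix (Fin N) (Fin N) F} {J : Matrix (Fin N) (Fin N) E} (hJ : J = T.map (algebraMap F E))
    (g : UnitaryGroup.localPi E c N J v) (w : PlacesOver E v) :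
    (((localPiGalConj E c N v hJ g : UnitaryGroup.localPi E c N J v) : UnitaryGroup.LocalGLPi E N v) w :
        Matrix (Fin N) (Fin N) (w.1.adicCompletion E)) =
      (((g : UnitaryGroup.LocalGLPi E N v) (PlacesOver.galInv c w) : GL (Fin N) ((PlacesOver.galInv c w).1.adicCompletion E)) :
          Matrix (Fin N) (Fin N) ((PlacesOver.galInv c w).1.adicCompletion E)).map (galAdicCompletionMap c (smul_inv_smul c w.1)) := by
  refine Matrix.ext fun a b => ?_
  change ((((localPiEquiv E c N J v).symm (localGalConj E c N v hJ (localPiEquiv E c N J v g)) : UnitaryGroup.localPi E c N J v) :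
      UnitaryGroup.LocalGLPi E N v) w : Matrix (Fin N) (Fin N) (w.1.adicCompletion E)) a b = _
  rw [coe_localPiEquiv_symm_apply, GLn.coe_piEquiv_apply, Matrix.map_apply, Matrix.map_apply]
  change ((localGalConj E c N v hJ (localPiEquiv E c N J v g)).1.1 a b) w = _
  rw [val_localGalConj, Matrix.map_apply, conjLocal_apply, coe_localPiEquiv_apply]
  rfl

omit [Algebra.IsQuadraticExtension F E] in
/-- The `Δ`-block of `p̄` at `w` is `c_*` of the `Δ`-block of `p` at `c⁻¹w`. [cite: Kudla1994, §3] -/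
theorem deltaBlock_localPiGalConj (p : UnitaryGroup.localPi E c (n + n) JD v) (w : PlacesOver E v) :
    deltaBlock F E c v n w (localPiGalConj E c (n + n) v hJD p) =
      (deltaBlock F E c v n (PlacesOver.galInv c w) p).map (galAdicCompletionMap c (smul_inv_smul c w.1)) := by
  simp only [deltaBlock]
  rw [coe_localPiGalConj_apply F E c v hJD p w]
  refine Matrix.ext fun i j => ?_
  simp only [Matrix.add_apply, Matrix.toBlocks₁₁, Matrix.toBlocks₁₂, Matrix.reindex_apply, Matrix.submatrix_apply,
    Matrix.of_apply, Matrix.map_apply, map_add]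

omit [Algebra.IsQuadraticExtension F E] in
/-- **`det_Δ(p̄)_w = c_*(det_Δ(p)_{c⁻¹w})`**: entrywise conjugation conjugates Kudla's `x(p)`. [cite: Kudla1994, §3] [cite: HarrisKudlaSweet1996, §1 (1.15)] -/
theorem detDelta_localPiGalConj (p : UnitaryGroup.localPi E c (n + n) JD v) (w : PlacesOver E v) :
    detDelta F E c v n w (localPiGalConj E c (n + n) v hJD p) =
      galAdicCompletionMap c (smul_inv_smul c w.1) (detDelta F E c v n (PlacesOver.galInv c w) p) := by
  unfold detDelta
  rw [deltaBlock_localPiGalConj F E c v n hJD p w, ← RingHom.mapMatrix_apply, ← RingHom.map_det]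

end Literature.NumberTheory.GelbartRogawski1991.UnitaryDualPair.LocalSplitting

end
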